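import Literature.Analysis.FunctionSpaces.UniformRandomWalkDensityTheta
import Literature.Analysis.SpecialFunctions.JacobiThetaEtaQuotient
import Literature.NumberTheory.QuadraticFields.ChowlaSelbergFifteenGenus
import Literature.NumberTheory.QuadraticFields.ChowlaSelbergFifteenLValues
import Literature.NumberTheory.QuadraticFields.ChowlaSelbergFifteenLPrime
import HarnessLib

/-!
# The Chowla–Selberg value at discriminant `−15` and Borwein–Straub–Wan–Zudilin eq. (5.3)

Fifth sibling file of `Literature/Analysis/FunctionSpaces/UniformRandomWalkDensity.lean`; it
DISCHARGES the named fact `BorweinStraubWanZudilin2012_eq_5_3` (the Borwein–Zucker /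
Chowla–Selberg value `K₁₅² = (1+√5)Γ(1/15)Γ(2/15)Γ(4/15)Γ(8/15)/(240π)` of the complete elliptic
integral at the 15th singular modulus, [BorweinEtAl2012, §5 eq. (5.3)]):
**`BorweinStraubWanZudilin2012_eq_5_3_holds`**. Everything is PROVED; no definition and no named
fact is introduced.

The proof is the classical one (Selberg–Chowla 1967 §2; Borwein–Borwein, *Pi and the AGM*, §9.2;
Zucker 1977), assembled from tree theorems:

1. `UniformRandomWalkDensityTheta.lean`: (5.3) `⟺ ϑ₃(i√15)⁴ = (1+√5)G/(60π³)`
   (`K(k₁₅) = (π/2)ϑ₃(i√15)²`, Jacobi inversion);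
2. `JacobiThetaEtaQuotient.lean`: `ϑ₃(i√15) = |η((1+i√15)/2)|²/|η(i√15)|` (`(ϑ₂ϑ₃ϑ₄)⁸ = 2⁸Δ`, level
   one, and Landen);
3. Kronecker's first limit formula (`EpsteinZetaKroneckerLimitExact.lean`) for the forms
   `Q₁ = (1,1,4)`, `Q₂ = (2,1,2)` (discriminant `−15`, CM points `(1+i√15)/2`, `(1+i√15)/4`) and
   `Q₃ = (1,0,15)` (CM point `i√15`), giving the constants `C_j = (2π/√D)(2γ − log(D/a) − 4log|η(τ_j)|)`;
4. `ChowlaSelbergFifteenSum.lean`: `C₁ + C₂ = 2(γL(1,χ₋₁₅) + L′(1,χ₋₁₅))`, `L(1,χ₋₁₅) = 2π/√15`;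
   `ChowlaSelbergFifteenGenus.lean` + `…LValues.lean`: `C₁ − C₂ = 2L(1,χ₋₃)L(1,χ₅)
   = (4π/(3√15)) log((1+√5)/2)`; `EpsteinZetaFifteenSublattices.lean`:
   `Z₃ = (1+2·4^{−s})Z₁ − 2·2^{−s}Z₂`, whence `C₃ = (3/2)C₁ − C₂` (`kroneckerConstant_Q₃`, this file);
5. `ChowlaSelbergFifteenLPrime.lean`: `L′(1,χ₋₁₅) = (2π/√15)(γ + log 2π − ½Σχ(a)log Γ(a/15))`
   (functional equation + Lerch), and `G·H = 16π⁴` (`prod_Gamma_fifteenths`).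

Eliminating `C₁, C₂, C₃` gives `8 log|η((1+i√15)/2)| − 4 log|η(i√15)| = log(φ G/(30π³))`,
`φ = (1+√5)/2` — i.e. `ϑ₃(i√15)⁴ = (1+√5)G/(60π³)` (`theta3_I_mul_sqrt_fifteen_pow_four`), the
Chowla–Selberg formula for `ℚ(√−15)` in theta form, and (5.3) follows.

## References

* [BorweinEtAl2012] J. M. Borwein, A. Straub, J. Wan, W. Zudilin, Densities of short uniform random
  walks, Canad. J. Math. 64 (2012) 961–990 = arXiv:1103.2995, §5 eq. (5.3) (with [bz92]).
* [BorweinBorwein1987] J. M. Borwein, P. B. Borwein, *Pi and the AGM* (1987), §9.2, Table 9.1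
  (`k₁₅`, `K(k₁₅)`).
* A. Selberg, S. Chowla, On Epstein's zeta-function, J. reine angew. Math. 227 (1967) 86–110, §2.
* I. J. Zucker, The evaluation in terms of Γ-functions of the periods of elliptic curves admitting
  complex multiplication, Math. Proc. Cambridge Philos. Soc. 82 (1977) 111–118.
-/

noncomputable section

open _root_.Real _root_.Complex _root_.Filter _root_.Topology
open scoped ModularForm

namespace Literature.Analysis.FunctionSpaces

open Literature.Analysis.SpecialFunctions
open Literature.NumberTheory.EllipticCurves.JacobiThetaNull
open Literature.Barriers.RiemannHypothesis
open Literature.NumberTheory.QuadraticFields (jacobiChar)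
open Literature.NumberTheory.QuadraticFields.KroneckerLimit
open Literature.NumberTheory.QuadraticFields.ChowlaSelbergFifteen

/-! ### The CM points of the three forms -/

/-- `√60 = 2√15`. [folklore] -/
theorem sqrt_sixty : Real.sqrt 60 = 2 * Real.sqrt 15 := by
  rw [show (60 : ℝ) = 2 ^ 2 * 15 by norm_num, Real.sqrt_mul (by norm_num), Real.sqrt_sq (by norm_num)]

/-- The CM point of `Q₁ = x² + xy + 4y²` is `τ₁ = (1 + i√15)/2`. [folklore] -/
theorem rootPoint_Q₁ : rootPoint 1 1 4 = (1 + I * Real.sqrt 15) / 2 := by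
  apply Complex.ext
  · simp [rootPoint]
  · simp only [rootPoint_im, starkK]
    have : (4 * 1 * 4 - 1 ^ 2 : ℝ) = 15 := by norm_num
    rw [this]
    simp

/-- The CM point of `Q₃ = x² + 15y²` is `τ₀ = i√15`. [folklore] -/
theorem rootPoint_Q₃ : rootPoint 1 0 15 = I * Real.sqrt 15 := by
  apply Complex.ext
  · simp [rootPoint]
  · simp only [rootPoint_im, starkK]
    have : (4 * 1 * 15 - 0 ^ 2 : ℝ) = 60 := by norm_num
    rw [this, sqrt_sixty]
    simp

/-! ### The Kronecker-limit constant of `Q₃` and `C₃ = (3/2)C₁ − C₂` -/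

/-- The Kronecker-limit constant of `Q₃ = x² + 15y²`:
`Z₃(s) − (π/√15)/(s−1) → (π/√15)(2γ − log 60 − 4 log|η(i√15)|)`. [cite: BorweinBorwein1987, §9.2] -/
theorem tendsto_Z₃ :
    Tendsto (fun s : ℝ => epsteinZeta 1 0 15 s - ((Real.pi / Real.sqrt 15 : ℝ) : ℂ) / ((s : ℂ) - 1))
      (𝓝[>] 1)
      (𝓝 ((Real.pi / Real.sqrt 15 * (2 * Real.eulerMascheroniConstant - Real.log 60 -
        4 * Real.log ‖ModularForm.eta (rootPoint 1 0 15)‖) : ℝ) : ℂ)) := by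
  have h := tendsto_epsteinZeta_sub_pole_eta isPosDefForm_Q₃
  have h60 : Real.sqrt (4 * 1 * 15 - 0 ^ 2) = 2 * Real.sqrt 15 := by
    rw [show (4 * 1 * 15 - 0 ^ 2 : ℝ) = 60 by norm_num, sqrt_sixty]
  have hs15 : Real.sqrt 15 ≠ 0 := Real.sqrt_ne_zero'.mpr (by norm_num)
  have e1 : (2 * Real.pi / Real.sqrt (4 * 1 * 15 - 0 ^ 2) : ℝ) = Real.pi / Real.sqrt 15 := by
    rw [h60]; field_simp
  have e2 : ((4 * 1 * 15 - 0 ^ 2) / 1 : ℝ) = 60 := by norm_num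
  rw [e1, e2] at h
  exact h

/-- The auxiliary function `g(z) = ½ + 2·4^{−z} − 2·2^{−z}` has `g(1) = 0` and `g′(1) = 0`
(`log 4 = 2 log 2`); hence `g(s)/(s − 1) → 0` as `s → 1`. [folklore] -/
theorem tendsto_aux_div :
    Tendsto (fun s : ℝ => ((1 : ℂ) / 2 + 2 * (4 : ℂ) ^ (-(s : ℂ)) - 2 * (2 : ℂ) ^ (-(s : ℂ))) /
      ((s : ℂ) - 1)) (𝓝[>] 1) (𝓝 0) := by
  set g : ℂ → ℂ := fun z => (1 : ℂ) / 2 + 2 * (4 : ℂ) ^ (-z) - 2 * (2 : ℂ) ^ (-z) with hg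
  have hg1 : g 1 = 0 := by
    simp only [hg, Complex.cpow_neg_one]
    norm_num
  -- derivative at `1`
  have h4 : HasDerivAt (fun z : ℂ => (4 : ℂ) ^ (-z)) ((4 : ℂ) ^ (-(1 : ℂ)) * Complex.log 4 * (-1)) 1 := by
    have := ((hasDerivAt_id (1 : ℂ)).neg).const_cpow (c := (4 : ℂ)) (Or.inl (by norm_num))
    exact this
  have h2 : HasDerivAt (fun z : ℂ => (2 : ℂ) ^ (-z)) ((2 : ℂ) ^ (-(1 : ℂ)) * Complex.log 2 * (-1)) 1 := by
    have := ((hasDerivAt_id (1 : ℂ)).neg).const_cpow (c := (2 : ℂ)) (Or.inl (by norm_num))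
    exact this
  have hlog2 : Complex.log 2 = ((Real.log 2 : ℝ) : ℂ) := by
    rw [show (2 : ℂ) = ((2 : ℝ) : ℂ) by norm_num, ← Complex.ofReal_log (by norm_num)]
  have hlog4 : Complex.log 4 = ((2 * Real.log 2 : ℝ) : ℂ) := by
    rw [show (4 : ℂ) = ((4 : ℝ) : ℂ) by norm_num, ← Complex.ofReal_log (by norm_num),
      show (4 : ℝ) = 2 ^ 2 by norm_num, Real.log_pow]
    push_cast
    ring
  have hgd : HasDerivAt g 0 1 := by
    have h' : HasDerivAt g (2 * ((4 : ℂ) ^ (-(1 : ℂ)) * Complex.log 4 * (-1)) -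
        2 * ((2 : ℂ) ^ (-(1 : ℂ)) * Complex.log 2 * (-1))) 1 :=
      ((h4.const_mul (2 : ℂ)).const_add ((1 : ℂ) / 2)).sub (h2.const_mul (2 : ℂ))
    refine h'.congr_deriv ?_
    rw [Complex.cpow_neg_one, Complex.cpow_neg_one, hlog4, hlog2]
    push_cast
    ring
  have ht := (hasDerivAt_iff_tendsto_slope.mp hgd).comp
    Literature.NumberTheory.QuadraticFields.Quadratic.tendsto_ofReal_nhdsGT_one
  refine ht.congr fun s => ?_
  simp only [Function.comp_apply, slope_def_field, hg1, sub_zero]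
  rfl

/-- **`C₃ = (3/2)C₁ − C₂`** for the Kronecker-limit constants of `Q₃ = (1,0,15)`, `Q₁ = (1,1,4)`,
`Q₂ = (2,1,2)`: from `Z₃ = (1 + 2·4^{−s})Z₁ − 2·2^{−s}Z₂` (`epsteinZeta_one_zero_fifteen`) and the
three Kronecker limits (the residual pole term is `(2π/√15)·g(s)/(s−1) → 0`).
[cite: BorweinBorwein1987, §9.2] -/
theorem kroneckerConstant_Q₃ :
    ((Real.pi / Real.sqrt 15 * (2 * Real.eulerMascheroniConstant - Real.log 60 -
        4 * Real.log ‖ModularForm.eta (rootPoint 1 0 15)‖) : ℝ) : ℂ) =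
      3 / 2 * ((2 * Real.pi / Real.sqrt 15 * (2 * Real.eulerMascheroniConstant - Real.log 15 -
        4 * Real.log ‖ModularForm.eta (rootPoint 1 1 4)‖) : ℝ) : ℂ) -
      ((2 * Real.pi / Real.sqrt 15 * (2 * Real.eulerMascheroniConstant - Real.log (15 / 2) -
        4 * Real.log ‖ModularForm.eta (rootPoint 2 1 2)‖) : ℝ) : ℂ) := by
  set P : ℝ := 2 * Real.pi / Real.sqrt 15 with hP
  set C₁ : ℝ := P * (2 * Real.eulerMascheroniConstant - Real.log 15 -
        4 * Real.log ‖ModularForm.eta (rootPoint 1 1 4)‖) with hC₁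
  set C₂ : ℝ := P * (2 * Real.eulerMascheroniConstant - Real.log (15 / 2) -
        4 * Real.log ‖ModularForm.eta (rootPoint 2 1 2)‖) with hC₂
  have hPc : ((Real.pi / Real.sqrt 15 : ℝ) : ℂ) = (P : ℂ) / 2 := by
    rw [hP]; push_cast; ring
  -- the decomposition of `Z₃ − (P/2)/(s−1)` for `s > 1`
  set F : ℝ → ℂ := fun s => epsteinZeta 1 0 15 s - ((Real.pi / Real.sqrt 15 : ℝ) : ℂ) / ((s : ℂ) - 1)
    with hF
  have hdecomp : ∀ s : ℝ, 1 < s → F s =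
      (1 + 2 * (4 : ℂ) ^ (-(s : ℂ))) * (epsteinZeta 1 1 4 s - (P : ℂ) / ((s : ℂ) - 1)) -
        2 * (2 : ℂ) ^ (-(s : ℂ)) * (epsteinZeta 2 1 2 s - (P : ℂ) / ((s : ℂ) - 1)) +
        (P : ℂ) * (((1 : ℂ) / 2 + 2 * (4 : ℂ) ^ (-(s : ℂ)) - 2 * (2 : ℂ) ^ (-(s : ℂ))) /
          ((s : ℂ) - 1)) := by
    intro s hs
    have hs' : 1 < (s : ℂ).re := by simpa using hs
    have hs1 : (s : ℂ) - 1 ≠ 0 := by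
      rw [sub_ne_zero]; exact_mod_cast (ne_of_gt hs)
    simp only [hF]
    rw [epsteinZeta_one_zero_fifteen hs', hPc]
    field_simp
    ring
  -- limits of the pieces
  have hc4 : Tendsto (fun s : ℝ => 1 + 2 * (4 : ℂ) ^ (-(s : ℂ))) (𝓝[>] 1) (𝓝 (1 + 2 * (4 : ℂ) ^ (-(1 : ℂ)))) := by
    have hc : Continuous fun z : ℂ => 1 + 2 * (4 : ℂ) ^ (-z) :=
      continuous_const.add (continuous_const.mul (continuous_id.neg.const_cpow (Or.inl (by norm_num))))
    exact (hc.tendsto (1 : ℂ)).comp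
      ((Complex.continuous_ofReal.tendsto (1 : ℝ)).mono_left (nhdsWithin_le_nhds (s := Set.Ioi 1)))
  have hc2 : Tendsto (fun s : ℝ => 2 * (2 : ℂ) ^ (-(s : ℂ))) (𝓝[>] 1) (𝓝 (2 * (2 : ℂ) ^ (-(1 : ℂ)))) := by
    have hc : Continuous fun z : ℂ => 2 * (2 : ℂ) ^ (-z) :=
      continuous_const.mul (continuous_id.neg.const_cpow (Or.inl (by norm_num)))
    exact (hc.tendsto (1 : ℂ)).comp
      ((Complex.continuous_ofReal.tendsto (1 : ℝ)).mono_left (nhdsWithin_le_nhds (s := Set.Ioi 1)))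
  have hZ₁ : Tendsto (fun s : ℝ => epsteinZeta 1 1 4 s - (P : ℂ) / ((s : ℂ) - 1)) (𝓝[>] 1) (𝓝 (C₁ : ℂ)) :=
    tendsto_Z₁
  have hZ₂ : Tendsto (fun s : ℝ => epsteinZeta 2 1 2 s - (P : ℂ) / ((s : ℂ) - 1)) (𝓝[>] 1) (𝓝 (C₂ : ℂ)) :=
    tendsto_Z₂
  have hlim := ((hc4.mul hZ₁).sub (hc2.mul hZ₂)).add (tendsto_aux_div.const_mul (P : ℂ))
  have hF' : Tendsto F (𝓝[>] 1) (𝓝 ((1 + 2 * (4 : ℂ) ^ (-(1 : ℂ))) * (C₁ : ℂ) -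
      2 * (2 : ℂ) ^ (-(1 : ℂ)) * (C₂ : ℂ) + (P : ℂ) * 0)) := by
    refine hlim.congr' ?_
    filter_upwards [self_mem_nhdsWithin] with s hs
    exact (hdecomp s hs).symm
  have huniq := tendsto_nhds_unique tendsto_Z₃ hF'
  rw [huniq, Complex.cpow_neg_one, Complex.cpow_neg_one]
  ring

/-! ### The Chowla–Selberg value `ϑ₃(i√15)⁴ = (1+√5)G/(60π³)` -/

/-- **`8 log|η((1+i√15)/2)| − 4 log|η(i√15)| = log(φ G/(30π³))`**, `φ = (1+√5)/2`,
`G = Γ(1/15)Γ(2/15)Γ(4/15)Γ(8/15)` — the Chowla–Selberg formula for `ℚ(√−15)` at the principal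
class, together with the value at `i√15`, obtained by eliminating the three Kronecker-limit
constants. [cite: BorweinBorwein1987, §9.2] -/
theorem log_eta_combination :
    8 * Real.log ‖ModularForm.eta (rootPoint 1 1 4)‖ - 4 * Real.log ‖ModularForm.eta (rootPoint 1 0 15)‖ =
      Real.log ((1 + Real.sqrt 5) / 2) +
        Real.log (Real.Gamma (1 / 15) * Real.Gamma (2 / 15) * Real.Gamma (4 / 15) * Real.Gamma (8 / 15)) -
        (Real.log 2 + Real.log 15 + 3 * Real.log Real.pi) := by
  have hπ := Real.pi_pos
  -- the three relations between `C₁, C₂, C₃` (complex identities of the tree)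
  have hS := kroneckerConstant_add
  rw [LFunction_chi_one, deriv_LFunction_chi_one] at hS
  have hD := kroneckerConstant_sub
  rw [two_mul_LFunction_three_mul_five] at hD
  have hT := kroneckerConstant_Q₃
  -- `G H = 16 π⁴`
  have hGH := congrArg Real.log prod_Gamma_fifteenths
  -- names
  set E₁ := Real.log ‖ModularForm.eta (rootPoint 1 1 4)‖ with hE₁
  set E₂ := Real.log ‖ModularForm.eta (rootPoint 2 1 2)‖ with hE₂
  set E₃ := Real.log ‖ModularForm.eta (rootPoint 1 0 15)‖ with hE₃
  set γ := Real.eulerMascheroniConstant with hγ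
  set P : ℝ := 2 * Real.pi / Real.sqrt 15 with hP
  set Gp := Real.Gamma (1 / 15) * Real.Gamma (2 / 15) * Real.Gamma (4 / 15) * Real.Gamma (8 / 15) with hGp
  set Hp := Real.Gamma (7 / 15) * Real.Gamma (11 / 15) * Real.Gamma (13 / 15) * Real.Gamma (14 / 15) with hHp
  set lφ := Real.log ((1 + Real.sqrt 5) / 2) with hlφ
  set Γs : ℝ := Real.log (Real.Gamma (1 / 15)) + Real.log (Real.Gamma (2 / 15)) +
      Real.log (Real.Gamma (4 / 15)) + Real.log (Real.Gamma (8 / 15)) -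
      Real.log (Real.Gamma (7 / 15)) - Real.log (Real.Gamma (11 / 15)) -
      Real.log (Real.Gamma (13 / 15)) - Real.log (Real.Gamma (14 / 15)) with hΓs
  have hP0 : P ≠ 0 := by positivity
  -- real forms of the three relations
  have hSr : P * (2 * γ - Real.log 15 - 4 * E₁) + P * (2 * γ - Real.log (15 / 2) - 4 * E₂) =
      2 * (γ * P + P * (γ + Real.log (2 * Real.pi) - Γs / 2)) := by
    exact_mod_cast hS
  have hDr : P * (2 * γ - Real.log 15 - 4 * E₁) - P * (2 * γ - Real.log (15 / 2) - 4 * E₂) =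
      4 * Real.pi / (3 * Real.sqrt 15) * lφ := by
    exact_mod_cast hD
  have hTr : Real.pi / Real.sqrt 15 * (2 * γ - Real.log 60 - 4 * E₃) =
      3 / 2 * (P * (2 * γ - Real.log 15 - 4 * E₁)) - P * (2 * γ - Real.log (15 / 2) - 4 * E₂) := by
    apply Complex.ofReal_injective
    have hT' := hT
    push_cast at hT' ⊢
    linear_combination hT'
  -- positivity of the Gamma values; `Γs = 2 log G − 4 log 2 − 4 log π`
  have p1 := Real.Gamma_pos_of_pos (show (0 : ℝ) < 1 / 15 by norm_num)
  have p2 := Real.Gamma_pos_of_pos (show (0 : ℝ) < 2 / 15 by norm_num)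
  have p4 := Real.Gamma_pos_of_pos (show (0 : ℝ) < 4 / 15 by norm_num)
  have p8 := Real.Gamma_pos_of_pos (show (0 : ℝ) < 8 / 15 by norm_num)
  have p7 := Real.Gamma_pos_of_pos (show (0 : ℝ) < 7 / 15 by norm_num)
  have p11 := Real.Gamma_pos_of_pos (show (0 : ℝ) < 11 / 15 by norm_num)
  have p13 := Real.Gamma_pos_of_pos (show (0 : ℝ) < 13 / 15 by norm_num)
  have p14 := Real.Gamma_pos_of_pos (show (0 : ℝ) < 14 / 15 by norm_num)
  have hG : 0 < Gp := by rw [hGp]; positivity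
  have hH : 0 < Hp := by rw [hHp]; positivity
  have hlG : Real.log Gp = Real.log (Real.Gamma (1 / 15)) + Real.log (Real.Gamma (2 / 15)) +
      Real.log (Real.Gamma (4 / 15)) + Real.log (Real.Gamma (8 / 15)) := by
    rw [hGp, Real.log_mul (by positivity) p8.ne', Real.log_mul (by positivity) p4.ne',
      Real.log_mul p1.ne' p2.ne']
  have hlH : Real.log Hp = Real.log (Real.Gamma (7 / 15)) + Real.log (Real.Gamma (11 / 15)) +
      Real.log (Real.Gamma (13 / 15)) + Real.log (Real.Gamma (14 / 15)) := by
    rw [hHp, Real.log_mul (by positivity) p14.ne', Real.log_mul (by positivity) p13.ne',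
      Real.log_mul p7.ne' p11.ne']
  rw [Real.log_mul hG.ne' hH.ne', Real.log_mul (x := (16 : ℝ)) (y := Real.pi ^ 4) (by norm_num) (by positivity),
    Real.log_pow, show (16 : ℝ) = 2 ^ 4 by norm_num, Real.log_pow] at hGH
  push_cast at hGH
  have hΓs' : Γs = 2 * Real.log Gp - 4 * Real.log 2 - 4 * Real.log Real.pi := by
    rw [hΓs]
    linarith [hGH, hlG, hlH]
  -- logarithms of the rational constants
  have hl152 : Real.log (15 / 2) = Real.log 15 - Real.log 2 := Real.log_div (by norm_num) (by norm_num)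
  have hl60 : Real.log 60 = Real.log 15 + 2 * Real.log 2 := by
    rw [show (60 : ℝ) = 15 * 2 ^ 2 by norm_num, Real.log_mul (by norm_num) (by norm_num), Real.log_pow]
    push_cast; ring
  have hl2π : Real.log (2 * Real.pi) = Real.log 2 + Real.log Real.pi :=
    Real.log_mul (by norm_num) hπ.ne'
  have hπ15 : Real.pi / Real.sqrt 15 = P / 2 := by rw [hP]; ring
  have h43 : 4 * Real.pi / (3 * Real.sqrt 15) = 2 / 3 * P := by
    rw [hP]; ring
  rw [hl152, hl2π, hΓs'] at hSr
  rw [hl152, h43] at hDr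
  rw [hl60, hl152, hπ15] at hTr
  -- eliminate: `P·(8E₁ − 4E₃) = P·(lφ + log G − log 2 − log 15 − 3 log π)`
  have key : P * (8 * E₁ - 4 * E₃) =
      P * (lφ + Real.log Gp - (Real.log 2 + Real.log 15 + 3 * Real.log Real.pi)) := by
    linear_combination (-1 / 2 : ℝ) * hSr + (3 / 2 : ℝ) * hDr + 2 * hTr
  exact mul_left_cancel₀ hP0 key

/-- **Chowla–Selberg at `D = −15` in theta form: `ϑ₃(i√15)⁴ = (1 + √5)·Γ(1/15)Γ(2/15)Γ(4/15)Γ(8/15)/(60π³)`**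
(numerically `1.0000415805…`). [cite: BorweinBorwein1987, §9.2] -/
theorem theta3_I_mul_sqrt_fifteen_pow_four :
    (theta3 (I * ↑(Real.sqrt 15))).re ^ 4 =
      (1 + Real.sqrt 5) *
          (Real.Gamma (1 / 15) * Real.Gamma (2 / 15) * Real.Gamma (4 / 15) * Real.Gamma (8 / 15)) /
        (60 * π ^ 3) := by
  have hy : (0 : ℝ) < Real.sqrt 15 := Real.sqrt_pos.mpr (by norm_num)
  have hθ := theta3_I_mul_re_eq_norm_eta' hy
  have hlog := log_eta_combination
  have h1 : ‖ModularForm.eta ((1 + I * Real.sqrt 15) / 2)‖ = ‖ModularForm.eta (rootPoint 1 1 4)‖ := by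
    rw [rootPoint_Q₁]
  have h0 : ‖ModularForm.eta (I * Real.sqrt 15)‖ = ‖ModularForm.eta (rootPoint 1 0 15)‖ := by
    rw [rootPoint_Q₃]
  rw [h1, h0] at hθ
  -- the two eta values
  set e₁ : ℝ := ‖ModularForm.eta (rootPoint 1 1 4)‖ with he₁
  set e₀ : ℝ := ‖ModularForm.eta (rootPoint 1 0 15)‖ with he₀
  have he₁pos : 0 < e₁ := by
    rw [he₁]
    exact norm_pos_iff.mpr (ModularForm.eta_ne_zero (show 0 < (rootPoint 1 1 4).im from by
      rw [rootPoint_im]; exact starkK_pos isPosDefForm_Q₁))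
  have he₀pos : 0 < e₀ := by
    rw [he₀]
    exact norm_pos_iff.mpr (ModularForm.eta_ne_zero (show 0 < (rootPoint 1 0 15).im from by
      rw [rootPoint_im]; exact starkK_pos isPosDefForm_Q₃))
  -- `ϑ₃⁴ = e₁⁸/e₀⁴ = exp(8 log e₁ − 4 log e₀)`
  have hπ := Real.pi_pos
  set Gp := Real.Gamma (1 / 15) * Real.Gamma (2 / 15) * Real.Gamma (4 / 15) * Real.Gamma (8 / 15) with hGp
  have hG : 0 < Gp := by
    have := Real.Gamma_pos_of_pos (show (0 : ℝ) < 1 / 15 by norm_num)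
    have := Real.Gamma_pos_of_pos (show (0 : ℝ) < 2 / 15 by norm_num)
    have := Real.Gamma_pos_of_pos (show (0 : ℝ) < 4 / 15 by norm_num)
    have := Real.Gamma_pos_of_pos (show (0 : ℝ) < 8 / 15 by norm_num)
    rw [hGp]; positivity
  have hφ : 0 < (1 + Real.sqrt 5) / 2 := by positivity
  have hexp : Real.exp (8 * Real.log e₁ - 4 * Real.log e₀) = e₁ ^ 8 / e₀ ^ 4 := by
    rw [Real.exp_sub, show 8 * Real.log e₁ = ((8 : ℕ) : ℝ) * Real.log e₁ by norm_num,
      show 4 * Real.log e₀ = ((4 : ℕ) : ℝ) * Real.log e₀ by norm_num, ← Real.log_pow, ← Real.log_pow,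
      Real.exp_log (pow_pos he₁pos 8), Real.exp_log (pow_pos he₀pos 4)]
  have hR : Real.log ((1 + Real.sqrt 5) / 2 * Gp / (2 * 15 * Real.pi ^ 3)) =
      Real.log ((1 + Real.sqrt 5) / 2) + Real.log Gp -
        (Real.log 2 + Real.log 15 + 3 * Real.log Real.pi) := by
    rw [Real.log_div (x := (1 + Real.sqrt 5) / 2 * Gp) (y := 2 * 15 * Real.pi ^ 3) (by positivity)
        (by positivity), Real.log_mul hφ.ne' hG.ne',
      Real.log_mul (x := 2 * 15) (y := Real.pi ^ 3) (by norm_num) (by positivity),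
      Real.log_mul (x := 2) (y := 15) (by norm_num) (by norm_num), Real.log_pow]
    push_cast
    ring
  have hmain : e₁ ^ 8 / e₀ ^ 4 = (1 + Real.sqrt 5) / 2 * Gp / (2 * 15 * Real.pi ^ 3) := by
    rw [← hexp, hlog, ← hR, Real.exp_log (by positivity)]
  rw [hθ, div_pow, ← pow_mul, show 2 * 4 = 8 by norm_num, hmain]
  ring

/-- **Borwein–Straub–Wan–Zudilin, eq. (5.3)** ([BorweinEtAl2012, §5]; Borwein–Zucker [bz92]): the
Chowla–Selberg value of the complete elliptic integral at the 15th singular modulus,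
`(√5/40)·Γ(1/15)Γ(2/15)Γ(4/15)Γ(8/15)/π⁴ = (3√5/π³)·((√5−1)/2)·K₁₅²`, i.e.
`K₁₅² = (1+√5)Γ(1/15)Γ(2/15)Γ(4/15)Γ(8/15)/(240π)`. Proof: `K₁₅ = (π/2)ϑ₃(i√15)²`
(`BorweinStraubWanZudilin2012_eq_5_3_iff_theta3_pow_four`) and the Chowla–Selberg theta value
`theta3_I_mul_sqrt_fifteen_pow_four`. [cite: BorweinEtAl2012, §5 eq. (5.3)] -/
theorem BorweinStraubWanZudilin2012_eq_5_3_holds : BorweinStraubWanZudilin2012_eq_5_3 :=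
  BorweinStraubWanZudilin2012_eq_5_3_iff_theta3_pow_four.2 theta3_I_mul_sqrt_fifteen_pow_four

end Literature.Analysis.FunctionSpaces
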